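import Summits.Parity.GeneralizedHardyLittlewood.Theorems.BeyondDiagonalBeatsQuarter.OffDiagCoreLevelsWindow
import Summits.Parity.GeneralizedHardyLittlewood.Theorems.BeyondDiagonalBeatsQuarter.OffDiagCoreUnitLevels
import HarnessLib

/-!
# Route `PrimeLevelFamEdge`, crux K_B (stmt-Parity-20343), line `diagonal_kernel_split` rev 4, plan Ω,
# node **L7d part 2, leaf S₁ — the windowed large-conductor family as `levelLargePart`s, block by block;
# the active-`s` count of a block; the unit cut is level-free on balanced cells**
# (L7D-PLAN rev 5 §5 (1)(3)(4); companion of `OffDiagCoreLevelsWindow` (W) and `OffDiagCoreLevels`)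

The funded piece FL is `coreWithW (𝟙_D·K_L)` (`OffDiagCoreSplitAlgebra`, `K_L = levelLargePart R {q} 1 n_x a_x`); after the
window truncation (W) its family part is `coreWin (𝟙_D·K_L) T G Q N Hf Δ′`. This file puts it in the shape the level large
sieve (prover-7 `norm_sum_mul_levelLargePart_le_of_multiplicity_zmod`) consumes:

* **`coreWin_largeKernel_eq_levelLargePart`** — `coreWin (D·K_L) = −re Σ_{cells} 𝟙[cop] Σ_{h₁} Σ_{s ∈ [−Sf,Sf]}
  levelLargePart R G (q ↦ 𝟙[¬(T < |s + ab/(q(r+1))|)]·coreLevelWeight D Hf Δ′ x q) n_x a_x` — ONE `levelLargePart` per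
  member `x = (cell, h₁, s)`, its level weight carrying the member's window;
* `levelLargePart_eq_sum_filter` — a level set split into blocks splits each `levelLargePart` additively
  (`sum_levelLargePart_singleton_mul` + `Finset.sum_fiberwise`), so the family is treated block by block;
* **`card_active_le`** — in a block `β₁ ≤ q ≤ β₂` (`β₁ ≥ 1`) the members `s` of one `(cell, h₁)` that are active at SOME
  level of the block number `≤ 2T + ab/(β₁(r+1)) − ab/(β₂(r+1)) + 1` (all lie in one real interval) — the `s`-factor of the
  block multiplicity `m_b` (times D6 `card_filter_switchClass_eq_le` for the `(l,m)`-factor);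
* `isUnit_level_iff_of_abs_lt` — for a prime level `q > |h₁| > 0` the unit cut `𝟙[h₁ unit mod q(r+1)]` equals the
  level-FREE `𝟙[h₁ unit mod (r+1)]` (D5c `isUnit_level_iff_not_dvd`; on balanced cells `|h₁| ≤ H* < N < q`).

Finite rearrangements and one count; standard axioms. Helper toward `stub_offDiagBelowSlack_io`; closes nothing.
«The programme SEARCHES and TYPES; no claim about Landau–Siegel zeros, Theorems 1–2 of arXiv:2211.02515 or
a repaired Margin232 until a kernel theorem says so.»
-/

noncomputable section

open Finset Real Polynomial

namespace Summit.Parity.GeneralizedHardyLittlewood.Theorems.BeyondDiagonalBeatsQuarter.OffDiag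

open Literature.NumberTheory.LFunctions Literature.NumberTheory.LFunctions.KMV2000
open Literature.NumberTheory.Sieve.FriedlanderIwaniecPrimes (fourier2)
open PeterssonSplit (nearBoxes)

/-! ### §1. The windowed family as one `levelLargePart` per member -/

open Classical in
/-- **`coreWin` of the large-conductor piece with the level sum innermost, as `levelLargePart`s.** For levels `G` with
`2 ≤ q ≤ Q`, `N ≤ q` on `G` (`N ≥ 1`), `Δ′ ≥ 0`, any `Hf`, `T`, and a level-free selector `D` with `‖D‖ ≤ 1`:
`coreWin (D·K_L) T G Q N Hf Δ′ = −re(Σ_{cell nest at Q} 𝟙[(l/d₁,r+1)=1]·Σ_{|h₁|≤H*} Σ_{|s| ≤ Sf}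
   levelLargePart R G (q ↦ 𝟙[¬(T < |s + ab/(q(r+1))|)]·coreLevelWeight D Hf Δ′ cell h₁ s q) (switchMod (r+1) s h₁) (switchClass (r+1) ab s h₁))`.
[cite: KowalskiMichelVanderKam2000, §6 p. 19 — derivation; Davenport1980, ch. 29 — derivation] -/
theorem coreWin_largeKernel_eq_levelLargePart (R : ℕ) (D : ℕ → ℕ → ℕ → ℕ → ℕ → ℕ × ℕ → ℤ → ℤ → ℂ)
    (T : ℕ → ℕ → ℕ → ℕ → ℕ → ℕ × ℕ → ℤ → ℕ) (G : Finset ℕ) (Q N : ℕ)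
    (Hf : ℕ → ℕ → ℕ → ℕ → ℕ → ℕ → ℕ × ℕ → ℕ) (Δ' : ℝ) :
    coreWin (fun q r l m d₁ d₂ i h₁ s ↦ D r l m d₁ d₂ i h₁ s *
        levelLargePart R {q} (fun _ ↦ (1 : ℂ)) (switchMod (r + 1) s h₁)
          (switchClass (r + 1) (((l / d₁ : ℕ) : ℤ) * (m / d₂ : ℕ)) s h₁)) T G Q N Hf Δ' =
      -((∑ r ∈ Finset.range (Q ^ 7), ∑ l ∈ Finset.Icc 1 ⌊qhat Q ^ Δ'⌋₊, ∑ m ∈ Finset.Icc 1 ⌊qhat Q ^ Δ'⌋₊,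
          ∑ d₁ ∈ l.divisors, ∑ d₂ ∈ m.divisors, ∑ i ∈ nearBoxes Q d₁ d₂ (Real.log Q ^ 4),
            if Nat.Coprime (l / d₁) (r + 1) then
              ∑ h₁ ∈ Icc (-((G.sup (fun q ↦ Hf q d₁ d₂ (l / d₁) (m / d₂) (r + 1) i) : ℕ) : ℤ))
                  ((G.sup (fun q ↦ Hf q d₁ d₂ (l / d₁) (m / d₂) (r + 1) i) : ℕ) : ℤ),
                ∑ s ∈ Icc (-((T r l m d₁ d₂ i h₁ +
                      ⌈|((((l / d₁ : ℕ) : ℤ) * (m / d₂ : ℕ) : ℤ) : ℝ) / ((N : ℝ) * ((r + 1 : ℕ) : ℝ))|⌉₊ : ℕ) : ℤ))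
                    ((T r l m d₁ d₂ i h₁ +
                      ⌈|((((l / d₁ : ℕ) : ℤ) * (m / d₂ : ℕ) : ℤ) : ℝ) / ((N : ℝ) * ((r + 1 : ℕ) : ℝ))|⌉₊ : ℕ) : ℤ),
                  levelLargePart R G (fun q ↦ if (T r l m d₁ d₂ i h₁ : ℝ) <
                        |(s : ℝ) + ((((l / d₁ : ℕ) : ℤ) * (m / d₂ : ℕ) : ℤ) : ℝ) / ((q * (r + 1) : ℕ) : ℝ)| then 0 else
                      coreLevelWeight D Hf Δ' r l m d₁ d₂ i h₁ s q)
                    (switchMod (r + 1) s h₁) (switchClass (r + 1) (((l / d₁ : ℕ) : ℤ) * (m / d₂ : ℕ)) s h₁)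
            else 0).re) := by
  unfold coreWin
  refine neg_re_congr ?_
  refine Finset.sum_congr rfl fun r _ ↦ Finset.sum_congr rfl fun l _ ↦ Finset.sum_congr rfl fun m _ ↦
    Finset.sum_congr rfl fun d₁ _ ↦ Finset.sum_congr rfl fun d₂ _ ↦ Finset.sum_congr rfl fun i _ ↦ ?_
  split_ifs with hcop
  · refine Finset.sum_congr rfl fun h₁ _ ↦ Finset.sum_congr rfl fun s _ ↦ ?_
    rw [← sum_levelLargePart_singleton_mul G _ (switchMod (r + 1) s h₁) R
      (switchClass (r + 1) (((l / d₁ : ℕ) : ℤ) * (m / d₂ : ℕ)) s h₁)]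
    refine Finset.sum_congr rfl fun q _ ↦ ?_
    by_cases hwin : (T r l m d₁ d₂ i h₁ : ℝ) <
        |(s : ℝ) + ((((l / d₁ : ℕ) : ℤ) * (m / d₂ : ℕ) : ℤ) : ℝ) / ((q * (r + 1) : ℕ) : ℝ)|
    · rw [if_pos hwin, if_pos hwin, mul_zero]
    · rw [if_neg hwin, if_neg hwin, levelSummand_selector_mul_kernel D
        (fun c A s h₁ q ↦ levelLargePart R {q} (fun _ ↦ (1 : ℂ)) (switchMod c s h₁) (switchClass c A s h₁))
        Hf Δ' r l m d₁ d₂ i h₁ s q]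
  · rfl

/-! ### §2. Blocks: a level set split into fibres splits each `levelLargePart` -/

/-- **Block additivity**: for any key `blk : ℕ → κ` and a finite index set `B` containing the keys of `G`,
`levelLargePart R G F n a = Σ_{b∈B} levelLargePart R (G.filter (blk · = b)) F n a`. [folklore] -/
theorem levelLargePart_eq_sum_filter {κ : Type*} [DecidableEq κ] (R : ℕ) (G : Finset ℕ) (F : ℕ → ℂ) {n : ℕ}
    (a : ZMod n) (blk : ℕ → κ) (B : Finset κ) (hB : ∀ q ∈ G, blk q ∈ B) :
    levelLargePart R G F n a = ∑ b ∈ B, levelLargePart R (G.filter (fun q ↦ blk q = b)) F n a := by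
  classical
  rw [← sum_levelLargePart_singleton_mul G F n R a]
  rw [← Finset.sum_fiberwise_of_maps_to hB]
  exact Finset.sum_congr rfl fun b _ ↦ sum_levelLargePart_singleton_mul _ F n R a

/-- The dyadic-free uniform block key: `q ↦ (q − N₀)/L` sends `(N₀, N₀ + ΛL]`-levels into `range (Λ+1)`; any level set
`G ⊆ [0, N₀ + Λ·L]` with `L ≥ 1` has keys in `range (Λ + 1)`. [folklore] -/
theorem blockKey_mem_range {N₀ L Λ q : ℕ} (hL : 1 ≤ L) (hq : q ≤ N₀ + Λ * L) :
    (q - N₀) / L ∈ Finset.range (Λ + 1) := by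
  rw [Finset.mem_range]
  have h1 : q - N₀ ≤ Λ * L := by omega
  have h2 : (q - N₀) / L ≤ Λ * L / L := Nat.div_le_div_right h1
  rw [Nat.mul_div_cancel _ (by omega)] at h2
  omega

/-- The fibre of the block key is an interval of levels: `(q − N₀)/L = b ↔ N₀ + bL ≤ q ≤ N₀ + bL + (L−1)` for `q ≥ N₀`,
`L ≥ 1`. [folklore] -/
theorem blockKey_eq_iff {N₀ L q b : ℕ} (hL : 1 ≤ L) (hq : N₀ ≤ q) :
    (q - N₀) / L = b ↔ N₀ + b * L ≤ q ∧ q ≤ N₀ + b * L + (L - 1) := by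
  have hLpos : 0 < L := by omega
  have h1 : b ≤ (q - N₀) / L ↔ b * L ≤ q - N₀ := Nat.le_div_iff_mul_le hLpos
  have h2 : (q - N₀) / L < b + 1 ↔ q - N₀ < (b + 1) * L := Nat.div_lt_iff_lt_mul hLpos
  rw [Nat.add_mul, one_mul] at h2
  set P := b * L with hP
  set D := (q - N₀) / L with hD
  constructor
  · intro h
    have ha : P ≤ q - N₀ := h1.mp h.ge
    have hb : q - N₀ < P + L := h2.mp (by omega)
    constructor <;> omega
  · rintro ⟨ha, hb⟩
    have h3 : b ≤ D := h1.mpr (by omega)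
    have h4 : D < b + 1 := h2.mpr (by omega)
    omega

/-! ### §3. The active members of a block -/

/-- **The active-`s` count of a block.** For `ab ≥ 0`, `1 ≤ β₁ ≤ β₂`, `c ≥ 1`, `T ≥ 0` and any finite `s`-range `S`: the
`s ∈ S` with `¬(T < |s + ab/(qc)|)` for SOME `q ∈ [β₁, β₂]` all lie in `[−T − ab/(β₁c), T − ab/(β₂c)]`, so
`#{active s} ≤ 2T + ab/(β₁c) − ab/(β₂c) + 1`. [folklore] -/
theorem card_active_le {u : ℝ} (hu : 0 ≤ u) {c : ℕ} (hc : 1 ≤ c) {β₁ β₂ : ℕ} (hβ₁ : 1 ≤ β₁) (hβ : β₁ ≤ β₂)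
    {T : ℝ} (hT : 0 ≤ T) (S : Finset ℤ) [DecidablePred (fun s : ℤ ↦ ∃ q ∈ Finset.Icc β₁ β₂,
      ¬ (T < |(s : ℝ) + u / ((q * c : ℕ) : ℝ)|))] :
    ((S.filter (fun s : ℤ ↦ ∃ q ∈ Finset.Icc β₁ β₂, ¬ (T < |(s : ℝ) + u / ((q * c : ℕ) : ℝ)|))).card : ℝ) ≤
      2 * T + (u / ((β₁ * c : ℕ) : ℝ) - u / ((β₂ * c : ℕ) : ℝ)) + 1 := by
  classical
  set lo : ℝ := -T - u / ((β₁ * c : ℕ) : ℝ) with hlo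
  set hi : ℝ := T - u / ((β₂ * c : ℕ) : ℝ) with hhi
  have hpos : ∀ q : ℕ, 1 ≤ q → (0 : ℝ) < ((q * c : ℕ) : ℝ) := fun q hq ↦ by
    have : 0 < q * c := Nat.mul_pos (by omega) (by omega)
    exact_mod_cast this
  have hanti : ∀ q q' : ℕ, 1 ≤ q → q ≤ q' → u / ((q' * c : ℕ) : ℝ) ≤ u / ((q * c : ℕ) : ℝ) := fun q q' hq hqq' ↦
    div_le_div_of_nonneg_left hu (hpos q hq) (by exact_mod_cast Nat.mul_le_mul_right c hqq')
  -- every active `s` is an integer point of `[lo, hi]`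
  have hsub : S.filter (fun s : ℤ ↦ ∃ q ∈ Finset.Icc β₁ β₂, ¬ (T < |(s : ℝ) + u / ((q * c : ℕ) : ℝ)|)) ⊆
      Finset.Icc ⌈lo⌉ ⌊hi⌋ := by
    intro s hs
    obtain ⟨q, hq, hqs⟩ := (Finset.mem_filter.mp hs).2
    rw [not_lt, abs_le] at hqs
    have hq1 : β₁ ≤ q := (Finset.mem_Icc.mp hq).1
    have hq2 : q ≤ β₂ := (Finset.mem_Icc.mp hq).2
    have h1 := hanti β₁ q hβ₁ hq1
    have h2 := hanti q β₂ (le_trans hβ₁ hq1) hq2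
    rw [Finset.mem_Icc, Int.ceil_le, Int.le_floor]
    constructor <;> [rw [hlo]; rw [hhi]] <;> linarith [hqs.1, hqs.2]
  have hcard := Finset.card_le_card hsub
  rw [Int.card_Icc] at hcard
  have hlohi : lo ≤ hi + 1 := by
    have := hanti β₁ β₂ hβ₁ hβ
    rw [hlo, hhi]; linarith
  have h1 : ((⌊hi⌋ + 1 - ⌈lo⌉).toNat : ℝ) ≤ hi - lo + 1 := by
    have hfl : (⌊hi⌋ : ℝ) ≤ hi := Int.floor_le hi
    have hce : lo ≤ (⌈lo⌉ : ℝ) := Int.le_ceil lo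
    by_cases hnn : 0 ≤ ⌊hi⌋ + 1 - ⌈lo⌉
    · have : (((⌊hi⌋ + 1 - ⌈lo⌉).toNat : ℤ) : ℝ) = ((⌊hi⌋ + 1 - ⌈lo⌉ : ℤ) : ℝ) := by
        rw [Int.toNat_of_nonneg hnn]
      have h' : (((⌊hi⌋ + 1 - ⌈lo⌉).toNat : ℝ)) = ((⌊hi⌋ : ℝ) + 1 - (⌈lo⌉ : ℝ)) := by
        have := this; push_cast at this ⊢; linarith
      rw [h']; linarith
    · rw [Int.toNat_eq_zero.mpr (by omega)]; push_cast; linarith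
  calc _ ≤ (((⌊hi⌋ + 1 - ⌈lo⌉).toNat : ℕ) : ℝ) := by exact_mod_cast hcard
    _ ≤ hi - lo + 1 := h1
    _ = 2 * T + (u / ((β₁ * c : ℕ) : ℝ) - u / ((β₂ * c : ℕ) : ℝ)) + 1 := by rw [hhi, hlo]; ring

/-! ### §4. The unit cut is level-free on balanced cells -/

/-- **For a prime level `q` exceeding `|h₁| > 0`, the unit cut does not see the level**:
`IsUnit (h₁ : ZMod (q·c)) ↔ IsUnit (h₁ : ZMod c)`. On the funded (balanced) cells `|h₁| ≤ H* < N < q`, so the family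
weight's unit indicator is level-free and D5c's correction family is empty. [folklore] -/
theorem isUnit_level_iff_of_abs_lt {q : ℕ} (hq : q.Prime) (c : ℕ) {h₁ : ℤ} (hh₀ : h₁ ≠ 0) (hh : |h₁| < q) :
    IsUnit ((h₁ : ℤ) : ZMod (q * c)) ↔ IsUnit ((h₁ : ℤ) : ZMod c) := by
  rw [isUnit_level_iff_not_dvd hq c h₁]
  constructor
  · exact fun h ↦ h.1
  · intro h
    refine ⟨h, fun hdvd ↦ ?_⟩
    have h1 := Int.le_of_dvd (abs_pos.mpr hh₀) ((dvd_abs _ _).mpr hdvd)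
    omega

end Summit.Parity.GeneralizedHardyLittlewood.Theorems.BeyondDiagonalBeatsQuarter.OffDiag
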